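import Mathlib
import Summits.Ventures.PercRepro2.Defs
import Summits.Ventures.PercRepro2.Independence
import Summits.Ventures.PercRepro2.Graph
import Summits.Ventures.PercRepro2.Exploration
import Summits.Ventures.PercRepro2.Events
import Summits.Ventures.PercRepro2.Induced

/-!
# The objects of R4+ at `|A| = 2` (blind cell PercRepro2, p1; definitions only)

`clusterFinset` (the cluster of `o` as a `Finset`), the good-quadruple correction `gqTerm`
(= the sum in typer-1's `explorationFunctional`), the flip mass `lossTerm`, the row `R4PlusTwo`
(R4+ at `|A| = 2` in GQ form), the constant `rhoZero` and the lead's residual inequality `H2`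
(proofs/LEAD-PROOFSHAPES.md §8.3, proofs/P1-R4PLUS2.md).
-/

namespace Summit.Ventures.PercRepro2

/-! ## The objects of R4+ at `|A| = 2` (definitions) -/

section R4PlusDefs

variable {V : Type*} {E : Type*} [Fintype E] [DecidableEq E] [Fintype V] [DecidableEq V]

/-- The cluster of `o` as a `Finset`. -/
def clusterFinset (ends : E → Sym2 V) (o : V) (ω : Config E) : Finset V :=
  Finset.univ.filter fun x => Conn ends ω o x

omit [DecidableEq E] in
/-- Membership in `clusterFinset`. -/
@[simp] lemma mem_clusterFinset {ends : E → Sym2 V} {o : V} {ω : Config E} {x : V} :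
    x ∈ clusterFinset ends o ω ↔ Conn ends ω o x := by
  simp [clusterFinset]

variable {R : Type*} [Field R] [LinearOrder R]

/-- `GQ(b) = ∑_{W ∩ A = ∅} P(C(o) = W) · min_{a ∈ A} P_{G∖W}(a ↔ b)` (the correction term of
Kozma–Nitzan's good quadruples, typer-1's `explorationFunctional` sum). -/
noncomputable def gqTerm (p : E → R) (ends : E → Sym2 V) (A : Finset V) (hA : A.Nonempty)
    (o b : V) : R :=
  ∑ W ∈ (Finset.univ : Finset (Finset V)).filter (fun W => Disjoint W A),
    prob p (clusterEvent ends o ↑W) * A.inf' hA (fun a => prob p (connDelEvent ends W a b))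

/-- `LOSS(a₁) = ∑_{W ∩ {a₁,a₂} = ∅} P(C(o) = W) · (P_{G∖W}(a₁ ↔ b) − P_{G∖W}(a₂ ↔ b))⁺`. -/
noncomputable def lossTerm (p : E → R) (ends : E → Sym2 V) (o a₁ a₂ b : V) : R :=
  ∑ W ∈ (Finset.univ : Finset (Finset V)).filter (fun W => Disjoint W {a₁, a₂}),
    prob p (clusterEvent ends o ↑W) *
      max 0 (prob p (connDelEvent ends W a₁ b) - prob p (connDelEvent ends W a₂ b))

/-- **R4+ at `|A| = 2`** (GQ form): `P(a₁ ↔ b) ≤ P(o ↔ {a₁,a₂}, o ↔ b) + GQ(b)`. -/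
def R4PlusTwo (p : E → R) (ends : E → Sym2 V) (o a₁ a₂ b : V) : Prop :=
  prob p (connEvent ends a₁ b) ≤
    prob p (hitEvent ends o {a₁, a₂} ∩ connEvent ends o b) +
      gqTerm p ends {a₁, a₂} (Finset.insert_nonempty a₁ {a₂}) o b

/-- `ρ₀ = P(a₁ ↔ b | a₁, b ∉ C(a₂))` (`0` if the condition is null). -/
noncomputable def rhoZero (p : E → R) (ends : E → Sym2 V) (a₁ a₂ b : V) : R :=
  prob p (connEvent ends a₁ b ∩ avoidAll ends a₂ {a₁, b}) / prob p (avoidAll ends a₂ {a₁, b})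

/-- **(H2)** (lead, LEAD-PROOFSHAPES §8.3): with `U = C(a₂)`,
`ρ₀ · P(o ∈ U, a₁ ∉ U, b ∉ U) + LOSS(a₁) ≤ P(o ∈ U, b ∈ U, a₁ ∉ U)`. -/
def H2 (p : E → R) (ends : E → Sym2 V) (o a₁ a₂ b : V) : Prop :=
  rhoZero p ends a₁ a₂ b * prob p (connEvent ends o a₂ ∩ avoidAll ends a₂ {a₁, b}) +
      lossTerm p ends o a₁ a₂ b ≤
    prob p (connEvent ends o a₂ ∩ connEvent ends a₂ b ∩ (connEvent ends a₂ a₁)ᶜ)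

end R4PlusDefs

end Summit.Ventures.PercRepro2
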